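import Mathlib
import HarnessLib
import Literature.Computability.AlgebraicComplexity.MonotoneStructure

/-!
# ValiantsHypothesis / MonotoneRestoration — `MonotoneRestorationQP`, line `Sketch`: row shadows

Support file for crux item `stmt-ValiantsHypothesis-15886`
(`Summit.ValiantsHypothesis.ValiantsHypothesis.Theses.MonotoneRestoration.MonotoneRestorationQP`),
line `Sketch`, Theorem γ (the cancellation-free strengthening of the crux is false): the
combinatorics of ROW SHADOWS used by the spine argument for stub G6
`stub_symmetricMonotone_choose_le_card` (invested seat xfam-a, direct attempt A).

The row shadow of a polynomial `q` in the matrix variables `x_{ij}` is the set of rows `i`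
occurring in some monomial of `q`; it is written inline as
`q.support.biUnion fun m => (rowDegrees m).support`.

* `exists_threeCycle_fixing` — three points outside `X` carry a `3`-cycle, an EVEN permutation
  fixing `X` pointwise.
* `rowSet_trichotomy` — if `|Xᶜ| ≥ 3` and a set of rows `R` is, under every even permutation `ρ`
  fixing `X` pointwise, either mapped to itself or to a set disjoint from itself, then `R ⊆ X`, or
  `R ⊇ Xᶜ`, or `R` is a subset of `Xᶜ` with at most one element (near-transitivity of the
  alternating group by `3`-cycles; no appeal to simplicity or to small-index subgroups).
* `rowShadow_rename` — the row shadow of `rename (ρ • ·) q` is `ρ` applied to the row shadow.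
* degree bookkeeping for row-multilinear monomials (`degree_le_card_of_rowDegrees_le_one`,
  `one_le_degree_of_rowDegrees_ne_zero`, `rowDegrees_sum`) and the support of a product of
  polynomials (`exists_sum_of_mem_support_prod` over any commutative semiring;
  `sum_mem_support_prod` over `ℝ≥0`, where nothing cancels: `add_mem_support_mul`).
-/

-- `Summit.ValiantsHypothesis.ValiantsHypothesis.…` is the tree's mandated single-conjunct layout
-- (Sub = Summit), so the duplicated namespace component is intended.
set_option linter.dupNamespace false

noncomputable section

namespace Summit.ValiantsHypothesis.ValiantsHypothesis.Theorems

open Literature.Computability.AlgebraicComplexity MvPolynomial Finset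
open scoped NNReal Pointwise

/-! ### Even permutations fixing a set pointwise -/

/-- For three distinct points `u, v, w` outside `X` the `3`-cycle `u ↦ v ↦ w ↦ u`
(`swap u w * swap u v`) is an even permutation fixing `X` pointwise and every other point.
[folklore] -/
theorem exists_threeCycle_fixing {n : ℕ} (X : Finset (Fin n)) {u v w : Fin n}
    (hu : u ∉ X) (hv : v ∉ X) (hw : w ∉ X) (huv : u ≠ v) (hvw : v ≠ w) (huw : u ≠ w) :
    ∃ ρ : Equiv.Perm (Fin n), (∀ x ∈ X, ρ x = x) ∧ Equiv.Perm.sign ρ = 1 ∧ ρ u = v ∧ ρ v = w ∧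
      ρ w = u ∧ ∀ x, x ≠ u → x ≠ v → x ≠ w → ρ x = x := by
  refine ⟨Equiv.swap u w * Equiv.swap u v, ?_, ?_, ?_, ?_, ?_, ?_⟩
  · intro x hx
    have hxu : x ≠ u := fun h => hu (h ▸ hx)
    have hxv : x ≠ v := fun h => hv (h ▸ hx)
    have hxw : x ≠ w := fun h => hw (h ▸ hx)
    rw [Equiv.Perm.mul_apply, Equiv.swap_apply_of_ne_of_ne hxu hxv,
      Equiv.swap_apply_of_ne_of_ne hxu hxw]
  · exact (Equiv.Perm.isThreeCycle_swap_mul_swap_same huw huv (Ne.symm hvw)).sign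
  · rw [Equiv.Perm.mul_apply, Equiv.swap_apply_left,
      Equiv.swap_apply_of_ne_of_ne (Ne.symm huv) hvw]
  · rw [Equiv.Perm.mul_apply, Equiv.swap_apply_right, Equiv.swap_apply_left]
  · rw [Equiv.Perm.mul_apply, Equiv.swap_apply_of_ne_of_ne (Ne.symm huw) (Ne.symm hvw),
      Equiv.swap_apply_right]
  · intro x hxu hxv hxw
    rw [Equiv.Perm.mul_apply, Equiv.swap_apply_of_ne_of_ne hxu hxv,
      Equiv.swap_apply_of_ne_of_ne hxu hxw]

/-- If `|X| + 3 ≤ n` then outside `X` there is a point different from two given ones.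
[folklore] -/
theorem exists_not_mem_ne_ne {n : ℕ} (X : Finset (Fin n)) (hX : X.card + 3 ≤ n) (a b : Fin n) :
    ∃ c : Fin n, c ∉ X ∧ c ≠ a ∧ c ≠ b := by
  classical
  have hc : ((univ \ X) \ {a, b}).Nonempty := by
    rw [← Finset.card_pos]
    have h1 := Finset.le_card_sdiff {a, b} (univ \ X)
    have h2 : (univ \ X).card = n - X.card := by
      rw [Finset.card_univ_sdiff, Fintype.card_fin]
    have h3 : ({a, b} : Finset (Fin n)).card ≤ 2 := Finset.card_le_two
    omega
  obtain ⟨c, hc⟩ := hc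
  simp only [mem_sdiff, mem_univ, true_and, mem_insert, mem_singleton, not_or] at hc
  exact ⟨c, hc.1, hc.2.1, hc.2.2⟩

/-- **Orbit trichotomy for row sets.** Let `|X| + 3 ≤ n` and let `R` be a set of rows such that
every EVEN permutation fixing `X` pointwise maps `R` either onto itself or onto a set disjoint
from `R` (the dichotomy satisfied by the row shadow of a child of a gate fixed by these
permutations). Then `R ⊆ X`, or `R ⊇ Xᶜ`, or `R ⊆ Xᶜ` has at most one element. Proof by
`3`-cycles: a `3`-cycle `a ↦ b ↦ c` inside `Xᶜ` moving a point of `R` to a non-point of `R` while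
keeping some point of `R` inside `R` contradicts the hypothesis. [folklore] -/
theorem rowSet_trichotomy {n : ℕ} (X R : Finset (Fin n)) (hX : X.card + 3 ≤ n)
    (h : ∀ ρ : Equiv.Perm (Fin n), (∀ x ∈ X, ρ x = x) → Equiv.Perm.sign ρ = 1 →
      R.map ρ.toEmbedding = R ∨ Disjoint (R.map ρ.toEmbedding) R) :
    R ⊆ X ∨ (∀ i, i ∉ X → i ∈ R) ∨ (R.card ≤ 1 ∧ Disjoint R X) := by
  classical
  by_cases hRX : ∃ x ∈ R, x ∈ X
  · -- `R` meets `X`: then `R` is stable under every even permutation fixing `X`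
    obtain ⟨x, hxR, hxX⟩ := hRX
    have stab : ∀ ρ : Equiv.Perm (Fin n), (∀ x ∈ X, ρ x = x) → Equiv.Perm.sign ρ = 1 →
        R.map ρ.toEmbedding = R := by
      intro ρ hρ hs
      rcases h ρ hρ hs with h1 | h1
      · exact h1
      · exfalso
        have hx : x ∈ R.map ρ.toEmbedding := mem_map.2 ⟨x, hxR, hρ x hxX⟩
        exact disjoint_left.1 h1 hx hxR
    rcases em (R ⊆ X) with h1 | h1
    · exact Or.inl h1
    rcases em (∀ i, i ∉ X → i ∈ R) with h2 | h2
    · exact Or.inr (Or.inl h2)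
    exfalso
    obtain ⟨a, haR, haX⟩ : ∃ a ∈ R, a ∉ X := not_subset.1 h1
    obtain ⟨b, hbX, hbR⟩ : ∃ b, b ∉ X ∧ b ∉ R := by
      by_contra hcon
      push Not at hcon
      exact h2 hcon
    obtain ⟨c, hcX, hca, hcb⟩ := exists_not_mem_ne_ne X hX a b
    have hab : a ≠ b := fun hab => hbR (hab ▸ haR)
    obtain ⟨ρ, hρX, hρs, hρa, -, -, -⟩ :=
      exists_threeCycle_fixing X haX hbX hcX hab (Ne.symm hcb) (Ne.symm hca)
    have hb : b ∈ R.map ρ.toEmbedding := mem_map.2 ⟨a, haR, hρa⟩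
    rw [stab ρ hρX hρs] at hb
    exact hbR hb
  · -- `R ⊆ Xᶜ`
    have hdisj : Disjoint R X := disjoint_left.2 fun x hxR hxX => hRX ⟨x, hxR, hxX⟩
    rcases le_or_gt R.card 1 with h1 | h1
    · exact Or.inr (Or.inr ⟨h1, hdisj⟩)
    rcases em (∀ i, i ∉ X → i ∈ R) with h2 | h2
    · exact Or.inr (Or.inl h2)
    exfalso
    obtain ⟨a, haR, a', ha'R, haa'⟩ := one_lt_card.1 h1
    obtain ⟨b, hbX, hbR⟩ : ∃ b, b ∉ X ∧ b ∉ R := by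
      by_contra hcon
      push Not at hcon
      exact h2 hcon
    have haX : a ∉ X := disjoint_left.1 hdisj haR
    have ha'X : a' ∉ X := disjoint_left.1 hdisj ha'R
    have ha'b : a' ≠ b := fun hh => hbR (hh ▸ ha'R)
    have hba : b ≠ a := fun hh => hbR (hh ▸ haR)
    -- the `3`-cycle `a' ↦ b ↦ a ↦ a'`
    obtain ⟨ρ, hρX, hρs, hρa', -, hρa, -⟩ :=
      exists_threeCycle_fixing X ha'X hbX haX ha'b hba (Ne.symm haa')
    rcases h ρ hρX hρs with h3 | h3
    · have hb : b ∈ R.map ρ.toEmbedding := mem_map.2 ⟨a', ha'R, hρa'⟩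
      rw [h3] at hb
      exact hbR hb
    · have h4 : a' ∈ R.map ρ.toEmbedding := mem_map.2 ⟨a, haR, hρa⟩
      exact disjoint_left.1 h3 h4 ha'R

/-! ### Row shadows of monomials and polynomials -/

/-- The row degrees of a renamed monomial: `rowDegrees (ρ • m) = ρ • rowDegrees m`. [folklore] -/
theorem rowDegrees_mapDomain_perm {n : ℕ} (ρ : Equiv.Perm (Fin n)) (m : Fin n × Fin n →₀ ℕ) :
    rowDegrees (Finsupp.mapDomain (fun x : Fin n × Fin n => ρ • x) m) =
      Finsupp.mapDomain ρ (rowDegrees m) := by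
  unfold rowDegrees
  rw [← Finsupp.mapDomain_comp, ← Finsupp.mapDomain_comp]
  rfl

/-- Rows of a renamed monomial are the renamed rows. [folklore] -/
theorem rowDegrees_mapDomain_perm_apply {n : ℕ} (ρ : Equiv.Perm (Fin n))
    (m : Fin n × Fin n →₀ ℕ) (i : Fin n) :
    rowDegrees (Finsupp.mapDomain (fun x : Fin n × Fin n => ρ • x) m) i =
      rowDegrees m (ρ.symm i) := by
  rw [rowDegrees_mapDomain_perm, Finsupp.mapDomain_equiv_apply]

/-- Membership in a row shadow, unfolded. [folklore] -/
theorem mem_rowShadow_iff {n : ℕ} {R : Type*} [CommSemiring R]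
    (q : MvPolynomial (Fin n × Fin n) R) (i : Fin n) :
    i ∈ q.support.biUnion (fun m => (rowDegrees m).support) ↔
      ∃ m ∈ q.support, rowDegrees m i ≠ 0 := by
  simp only [mem_biUnion, Finsupp.mem_support_iff]

/-- **The row shadow of a renamed polynomial** is the renamed row shadow: the rows occurring in
`rename (ρ • ·) q` are `ρ` of the rows occurring in `q`. [folklore] -/
theorem rowShadow_rename {n : ℕ} {R : Type*} [CommSemiring R] (ρ : Equiv.Perm (Fin n))
    (q : MvPolynomial (Fin n × Fin n) R) :
    (rename (fun x : Fin n × Fin n => ρ • x) q).support.biUnion (fun m => (rowDegrees m).support) =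
      (q.support.biUnion fun m => (rowDegrees m).support).map ρ.toEmbedding := by
  classical
  have hinj : Function.Injective (fun x : Fin n × Fin n => ρ • x) := MulAction.injective ρ
  ext i
  rw [mem_rowShadow_iff, mem_map_equiv, mem_rowShadow_iff, support_rename_of_injective hinj]
  constructor
  · rintro ⟨m, hm, hi⟩
    obtain ⟨m₀, hm₀, rfl⟩ := mem_image.1 hm
    rw [rowDegrees_mapDomain_perm_apply] at hi
    exact ⟨m₀, hm₀, hi⟩
  · rintro ⟨m₀, hm₀, hi⟩
    refine ⟨Finsupp.mapDomain (fun x : Fin n × Fin n => ρ • x) m₀, mem_image_of_mem _ hm₀, ?_⟩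
    rwa [rowDegrees_mapDomain_perm_apply]

/-- Row degrees are additive over finite sums of monomials. [folklore] -/
theorem rowDegrees_sum {ι κ α : Type*} (s : Finset α) (μ : α → (ι × κ →₀ ℕ)) :
    rowDegrees (∑ x ∈ s, μ x) = ∑ x ∈ s, rowDegrees (μ x) := by
  unfold rowDegrees
  exact Finsupp.mapDomain_finsetSum

/-- A row-multilinear monomial (every row degree `≤ 1`) whose rows lie in `S` has degree at most
`|S|`. [folklore] -/
theorem degree_le_card_of_rowDegrees_le_one {ι κ : Type*} {μ : ι × κ →₀ ℕ} (S : Finset ι)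
    (h1 : ∀ i, rowDegrees μ i ≤ 1) (hS : ∀ i, rowDegrees μ i ≠ 0 → i ∈ S) :
    μ.degree ≤ S.card := by
  rw [← degree_rowDegrees, Finsupp.degree_apply]
  calc ∑ i ∈ (rowDegrees μ).support, rowDegrees μ i
      ≤ ∑ i ∈ (rowDegrees μ).support, 1 := sum_le_sum fun i _ => h1 i
    _ = (rowDegrees μ).support.card := by simp
    _ ≤ S.card := card_le_card fun i hi => hS i (Finsupp.mem_support_iff.1 hi)

/-- A monomial with a nonzero row degree has degree at least `1`. [folklore] -/
theorem one_le_degree_of_rowDegrees_ne_zero {ι κ : Type*} {μ : ι × κ →₀ ℕ} {i : ι}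
    (h : rowDegrees μ i ≠ 0) : 1 ≤ μ.degree := by
  rw [← degree_rowDegrees]
  exact le_trans (Nat.one_le_iff_ne_zero.2 h) (Finsupp.le_degree i _)

/-! ### Supports of products -/

/-- A monomial of a finite product of polynomials is a sum of monomials of the factors (any
commutative semiring: `support_mul`). [folklore] -/
theorem exists_sum_of_mem_support_prod {σ R α : Type*} [CommSemiring R] [DecidableEq α]
    (s : Finset α) (q : α → MvPolynomial σ R) {m : σ →₀ ℕ} (hm : m ∈ (∏ x ∈ s, q x).support) :
    ∃ μ : α → (σ →₀ ℕ), (∀ x ∈ s, μ x ∈ (q x).support) ∧ ∑ x ∈ s, μ x = m := by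
  classical
  induction s using Finset.induction_on generalizing m with
  | empty =>
    refine ⟨fun _ => 0, by simp, ?_⟩
    rw [prod_empty] at hm
    have h1 : (1 : MvPolynomial σ R) = monomial 0 1 := by rw [← C_1, C_apply]
    rw [h1] at hm
    have := support_monomial_subset hm
    rw [mem_singleton] at this
    rw [sum_empty, this]
  | insert a s ha ih =>
    rw [prod_insert ha] at hm
    obtain ⟨m₁, hm₁, m₂, hm₂, rfl⟩ := Finset.mem_add.1 (support_mul _ _ hm)
    obtain ⟨μ, hμ, hsum⟩ := ih hm₂
    refine ⟨Function.update μ a m₁, ?_, ?_⟩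
    · intro x hx
      rcases mem_insert.1 hx with rfl | hx
      · rwa [Function.update_self]
      · rw [Function.update_of_ne (ne_of_mem_of_not_mem hx ha)]
        exact hμ x hx
    · rw [sum_insert ha, Function.update_self, ← hsum]
      congr 1
      exact sum_congr rfl fun x hx => Function.update_of_ne (ne_of_mem_of_not_mem hx ha) _ _

/-- Over `ℝ≥0` nothing cancels: a sum of monomials of the factors is a monomial of the product
(`add_mem_support_mul`, iterated). [folklore] -/
theorem sum_mem_support_prod {ι κ α : Type*} [DecidableEq α] (s : Finset α)
    (q : α → MvPolynomial (ι × κ) ℝ≥0) (μ : α → (ι × κ →₀ ℕ))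
    (h : ∀ x ∈ s, μ x ∈ (q x).support) : ∑ x ∈ s, μ x ∈ (∏ x ∈ s, q x).support := by
  classical
  induction s using Finset.induction_on with
  | empty => simp
  | insert a s ha ih =>
    rw [sum_insert ha, prod_insert ha]
    exact add_mem_support_mul (h a (mem_insert_self a s))
      (ih fun x hx => h x (mem_insert_of_mem hx))

end Summit.ValiantsHypothesis.ValiantsHypothesis.Theorems

end
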